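import Summits.ResolutionOfSingularities.ResolutionOfSingularities.Theorems.FrobeniusLadderFRationalResolutionPointBlowupEtale
import Summits.ResolutionOfSingularities.ResolutionOfSingularities.Theorems.FrobeniusLadderFRationalResolutionIsolatedClosed
import Mathlib.AlgebraicGeometry.Morphisms.Etale
import Mathlib.RingTheory.Unramified.LocalRing
import Mathlib.RingTheory.Unramified.Locus
import HarnessLib

/-!
# Crux `FrobeniusLadder.FRationalResolution` (stmt-ResolutionOfSingularities-15317), line `redirect`,
# stub `stub_diagonalizableQuotientResolution` — from an ÉTALE MORPHISM chart to the ring data (brick E)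

The endgame stub presents `X` by étale MORPHISMS `φ : Y ⟶ X` (`Y = Spec S₀`); the transfer chain
(`…PointBlowupEtale.hasResolution_of_pointBlowup_flat_charts`) consumes RING data: an affine open `Spec B ↪ X` around the
isolated singular point, a flat finitely presented unramified `B`-algebra `C`, primes `𝔭 ↦ 𝔔`. This file extracts the
ring data from the morphism (Mathlib: `Etale.etale_appLE`, `IsAffineOpen.fromSpec`, `IsAffineOpen.primeIdealOf`,
`IsAffineOpen.comap_primeIdealOf_appLE`, `Algebra.isUnramifiedAt_iff_map_eq`):

* `hloc_of_etale_chart_pointBlowup` — **if an isolated singular point `x` is the image of a point `y` of an étale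
  `X`-scheme `Y` such that the blow-up of every affine open neighbourhood `V ∋ y` at `y` is regular, then `x` has the
  local resolution datum `hloc`** (no residue-field condition);
* **`hasResolution_of_isolated_etale_pointBlowup`** — an integral `X` locally of finite type over any field whose
  singular locus is finite and étale-locally of this kind at each singular point HAS A RESOLUTION OF SINGULARITIES.

Honest label: plumbing + assembly (no stub closed by name; with `…VeroneseEtale.vertexIdeal_isMaximal` /
`veroneseCone_isRegular_affineBlowup` the remaining input for Veronese-cone charts is the restriction of the vertex
blow-up to affine neighbourhoods). No definitions, no named facts, no sorry. [folklore; cite: Kollar2007, §2.2]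
-/

noncomputable section

-- single-problem summit: the doubled namespace component is forced
set_option linter.dupNamespace false

open CategoryTheory AlgebraicGeometry TopologicalSpace
open Literature.AlgebraicGeometry.Resolution

namespace Summit.ResolutionOfSingularities.ResolutionOfSingularities.Theorems.FRationalResolution.EtaleChartExtraction

/-- **`hloc` at an isolated singular point from an étale chart whose point blow-ups are regular.** Let `X` be an
integral `k`-scheme locally of finite type with finite singular locus, `x` a singular point, `φ : Y → X` étale with
`φ y = x`, and suppose that for every affine open `V ∋ y` of `Y` the blow-up of `Spec Γ(Y, V)` at the prime of `y` is
regular. Then `x` has an open neighbourhood `W` containing no other singular point and a proper `ρ : Z → W`, `Z`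
regular, an isomorphism over `W ∩ Reg X` with dense preimage. [cite: Kollar2007, §2.2] -/
theorem hloc_of_etale_chart_pointBlowup (k : Type) [Field k] (X : Scheme.{0}) [IsIntegral X]
    (f : X ⟶ Spec (.of k)) [LocallyOfFiniteType f] (hfin : (Scheme.regularLocus X)ᶜ.Finite)
    {Y : Scheme.{0}} (φ : Y ⟶ X) [Etale φ] (y : Y) (hx : φ y ∉ Scheme.regularLocus X)
    (hbl : ∀ (V : Y.Opens) (hV : IsAffineOpen V) (hyV : y ∈ V),
      Scheme.IsRegular (affineBlowup (hV.primeIdealOf ⟨y, hyV⟩).asIdeal)) :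
    ∃ (W : X.Opens), φ y ∈ W ∧ (∀ t : X, t ∉ Scheme.regularLocus X → t ∈ W → t = φ y) ∧
      ∃ (Z : Scheme.{0}) (ρ : Z ⟶ W), IsProper ρ ∧ Scheme.IsRegular Z ∧
        IsIso (ρ ∣_ (W.ι ⁻¹ᵁ ⟨Scheme.regularLocus X, isOpen_regularLocus_of_locallyOfFiniteType_field f⟩)) ∧
        Dense ((ρ ⁻¹ᵁ (W.ι ⁻¹ᵁ ⟨Scheme.regularLocus X,
          isOpen_regularLocus_of_locallyOfFiniteType_field f⟩) : Z.Opens) : Set Z) := by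
  classical
  set x := φ y with hxdef
  -- (1) the other singular points form a finite set of closed points; remove them
  set T : Set X := (Scheme.regularLocus X)ᶜ \ {x} with hT
  have hTfin : T.Finite := hfin.subset Set.sdiff_subset
  have hTclosed : IsClosed T := by
    have : T = ⋃ z ∈ T, {z} := (Set.biUnion_of_singleton T).symm
    rw [this]
    exact hTfin.isClosed_biUnion fun z hz =>
      IsolatedClosed.isClosed_singleton_of_finite_singularLocus k X f hfin hz.1
  let W₀ : X.Opens := ⟨Tᶜ, hTclosed.isOpen_compl⟩
  have hxW₀ : x ∈ W₀ := fun h => h.2 rfl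
  -- (2) an affine open `U ∋ x` inside `W₀`
  obtain ⟨U, hU, hxU, hUW⟩ := exists_isAffineOpen_mem_and_subset (U := W₀) hxW₀
  haveI : Nonempty U := ⟨⟨x, hxU⟩⟩
  set ι := hU.fromSpec with hιdef
  set 𝔭 := hU.primeIdealOf ⟨x, hxU⟩ with h𝔭def
  have hι𝔭 : ι 𝔭 = x := hU.fromSpec_primeIdealOf ⟨x, hxU⟩
  have hxcl : IsClosed ({x} : Set X) := IsolatedClosed.isClosed_singleton_of_finite_singularLocus k X f hfin hx
  haveI h𝔭max : 𝔭.asIdeal.IsMaximal := hU.primeIdealOf_isMaximal_of_isClosed ⟨x, hxU⟩ hxcl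
  -- points of `Spec Γ(X,U)` other than `𝔭` are regular
  have hregB : ∀ P : Spec Γ(X, U), P.asIdeal ≠ 𝔭.asIdeal → P ∈ Scheme.regularLocus (Spec Γ(X, U)) := by
    intro P hP
    rw [mem_regularLocus_iff_of_flat_of_isPreimmersion ι]
    have hPU : ι P ∈ U := by
      have : ι P ∈ Set.range ι := ⟨P, rfl⟩
      rwa [hιdef, hU.range_fromSpec] at this
    have hPx : ι P ≠ x := by
      intro h
      apply hP
      have : P = 𝔭 := ι.isOpenEmbedding.injective (h.trans hι𝔭.symm)
      rw [this]
    by_contra hnreg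
    exact hUW hPU ⟨hnreg, hPx⟩
  -- `𝔭 ≠ 0`: otherwise `Spec Γ(X,U) = {𝔭}` and the dense regular locus would contain `x`
  have h𝔭0 : 𝔭.asIdeal ≠ ⊥ := by
    intro h0
    have hbot : (⊥ : Ideal Γ(X, U)).IsMaximal := h0 ▸ h𝔭max
    obtain ⟨t, htU, htreg⟩ := (Scheme.dense_regularLocus X).inter_open_nonempty U U.2 ⟨x, hxU⟩
    have htr : t ∈ Set.range ι := by rw [hιdef, hU.range_fromSpec]; exact htU
    obtain ⟨P, rfl⟩ := htr
    have hP : P.asIdeal = 𝔭.asIdeal := by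
      rw [h0]
      exact (hbot.eq_of_le P.isPrime.ne_top bot_le).symm
    have hP' : P = 𝔭 := PrimeSpectrum.ext hP
    rw [hP', hι𝔭] at htreg
    exact hx htreg
  -- (3) the `k`-algebra structure of `Γ(X,U)`
  obtain ⟨gk, hgk⟩ := Spec.map_surjective (ι ≫ f)
  letI : Algebra k Γ(X, U) := gk.hom.toAlgebra
  have hιf : ι ≫ f = Spec.map (CommRingCat.ofHom (algebraMap k Γ(X, U))) := by
    rw [← hgk]; rfl
  haveI : Algebra.FiniteType k Γ(X, U) := by
    have h1 : LocallyOfFiniteType (Spec.map gk) := by rw [hgk]; infer_instance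
    rw [HasRingHomProperty.Spec_iff (P := @LocallyOfFiniteType)] at h1
    exact h1
  -- (4) the chart ring: an affine open `V ∋ y` over `U`
  have hyU : y ∈ φ ⁻¹ᵁ U := hxU
  obtain ⟨V, hV, hyV, hVU⟩ := exists_isAffineOpen_mem_and_subset (U := φ ⁻¹ᵁ U) hyU
  have e : V ≤ φ ⁻¹ᵁ U := hVU
  set ψ := φ.appLE U V e with hψdef
  have hψ : ψ.hom.Etale := φ.etale_appLE hU hV e
  letI : Algebra Γ(X, U) Γ(Y, V) := ψ.hom.toAlgebra
  haveI : Algebra.Etale Γ(X, U) Γ(Y, V) := hψ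
  set 𝔔 := hV.primeIdealOf ⟨y, hyV⟩ with h𝔔def
  have hcomap : 𝔔.asIdeal.comap (algebraMap Γ(X, U) Γ(Y, V)) = 𝔭.asIdeal := by
    have h := hU.comap_primeIdealOf_appLE (f := φ) U V hV e hyV
    exact congrArg PrimeSpectrum.asIdeal h
  haveI : 𝔔.asIdeal.LiesOver 𝔭.asIdeal := ⟨hcomap.symm⟩
  have hover : 𝔭.asIdeal ≤ 𝔔.asIdeal.comap (algebraMap Γ(X, U) Γ(Y, V)) := hcomap.ge
  -- unramified at `𝔔`
  have hunr : 𝔭.asIdeal.map (algebraMap Γ(X, U) (Localization.AtPrime 𝔔.asIdeal)) =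
      IsLocalRing.maximalIdeal (Localization.AtPrime 𝔔.asIdeal) := by
    letI := Localization.AtPrime.algebraOfLiesOver 𝔭.asIdeal 𝔔.asIdeal
    haveI : Algebra.IsUnramifiedAt Γ(X, U) 𝔔.asIdeal :=
      (Algebra.formallyUnramified_iff_forall).mp inferInstance 𝔔
    exact ((Algebra.isUnramifiedAt_iff_map_eq Γ(X, U) 𝔭.asIdeal 𝔔.asIdeal).mp inferInstance).2
  -- (5) transfer
  have hsing : ι ⟨𝔭.asIdeal, h𝔭max.isPrime⟩ ∉ Scheme.regularLocus X := by
    change ι 𝔭 ∉ _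
    rw [hι𝔭]; exact hx
  obtain ⟨W, hxW, huniq, Z, ρ, hρ, hZ, hiso, hdense⟩ :=
    PointBlowupEtale.hloc_of_pointBlowup_flat_chart k X f ι hιf 𝔭.asIdeal h𝔭0 hsing hregB 𝔔.asIdeal
      hover hunr (hbl V hV hyV)
  have hpt : ι ⟨𝔭.asIdeal, h𝔭max.isPrime⟩ = x := hι𝔭
  rw [hpt] at hxW huniq
  exact ⟨W, hxW, huniq, Z, ρ, hρ, hZ, hiso, hdense⟩

/-- **RESOLUTION OF VARIETIES WHOSE ISOLATED SINGULARITIES ARE RESOLVED ÉTALE-LOCALLY BY ONE POINT BLOW-UP (chart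
given as an étale MORPHISM).** Let `X` be an integral `k`-scheme locally of finite type (any field `k`) with finitely
many singular points, each the image of a point `y` of an étale `X`-scheme `Y` such that the blow-up of every affine
open `V ∋ y` at `y` is regular (e.g. `Y` a Veronese cone `𝔸ⁿ/μ_r`, `y` its vertex). Then `X` has a resolution of
singularities. [cite: Kollar2007, §2.2] -/
theorem hasResolution_of_isolated_etale_pointBlowup (k : Type) [Field k] (X : Scheme.{0}) [IsIntegral X]
    (f : X ⟶ Spec (.of k)) [LocallyOfFiniteType f] (hfin : (Scheme.regularLocus X)ᶜ.Finite)
    (hchart : ∀ x : X, x ∉ Scheme.regularLocus X →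
      ∃ (Y : Scheme.{0}) (φ : Y ⟶ X) (_ : Etale φ) (y : Y), φ y = x ∧
        ∀ (V : Y.Opens) (hV : IsAffineOpen V) (hyV : y ∈ V),
          Scheme.IsRegular (affineBlowup (hV.primeIdealOf ⟨y, hyV⟩).asIdeal)) :
    Scheme.HasResolution X := by
  refine IsolatedGlue.hasResolution_of_finite_singularLocus_of_local k X f hfin fun s hs => ?_
  obtain ⟨Y, φ, _, y, hys, hbl⟩ := hchart s hs
  subst hys
  exact hloc_of_etale_chart_pointBlowup k X f hfin φ y hs hbl

end Summit.ResolutionOfSingularities.ResolutionOfSingularities.Theorems.FRationalResolution.EtaleChartExtraction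

end
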